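import Summits.BirchSwinnertonDyer.BirchSwinnertonDyer.Theses.CyclotomicUntwist
import Summits.BirchSwinnertonDyer.BirchSwinnertonDyer.Theses.SemiOrdinaryEisensteinDescent
import Summits.BirchSwinnertonDyer.BirchSwinnertonDyer.Theorems.WildThreeRankOneBSDpOfExactIndexManin
import Literature.NumberTheory.EllipticCurves.BSDHeegnerPointsGrossZagierProofs
import Literature.NumberTheory.EllipticCurves.KrizLi2019.SexticTwistBSDThreeDescent
import Literature.NumberTheory.EllipticCurves.GlobalMinimalModelProofs
import HarnessLib

/-!
# Route `CyclotomicUntwist`, crux K2 `PSRankOneUpperHalfAtThree` (stmt-BirchSwinnertonDyer-21581) BY NAME from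
# the cruxes of route `SemiOrdinaryEisensteinDescent`: Kolyvagin crux Ko + rank-zero wild leaf Z + non-tower
# residual NT ⟹ the Euler-system UPPER half on EVERY onto wild rank-one row (cross-route kernel)

Cell `bsd-wall` (W-ALL, row 2 @3), prover seat `bsd-line-cycu-p3` (g0), 2026-08-27. HONEST FRAMING: a
CONDITIONAL kernel — every crux named below is an ANTECEDENT; the file closes nothing and proves BSD₃ for
no curve; 0 definitions, 0 named facts minted, 0 `sorry`.

WHAT IT RECORDS. Route `CyclotomicUntwist` (CU) files the upper half `Typed.MissingUpperBoundAt W 3` on the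
PRINCIPAL-SERIES rows of the onto wild rank-one leaf `WAllExclAddWildRankOneSurj` as its crux #3
`PSRankOneUpperHalfAtThree` («Kolyvagin's bound at `p = 3` with Jetchev's Tamagawa sharpening»). Route
`SemiOrdinaryEisensteinDescent` (SOED) already carries, on the WHOLE leaf, the Kolyvagin crux
`WildKolyvaginUpperAtThree` (Ko, item 20480: the co-STEP-L socket `Upper.IndexUpperBoundLeAt W 3 K P (v₃ c)` on
the `3`-adic-tower-surjective rows), the rank-zero wild leaf `WildRankZeroTwistAtThree`
(Z = `WAllExclAddWildRankZero`, item 20387) and the non-tower residual `WildRankOneSurjNonTowerAtThree` (NT,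
item 20484). This file proves, with the tree's Gross–Zagier bookkeeping only (no `p`-adic input, no
Eisenstein inclusion, no Waldspurger value, no control):

* §1 `upperHalf_towerRows_of_kolyvaginCrux_of_rankZeroLeaf` — on the tower-surjective onto wild rows with
  `r_an = 1`: published inputs ∧ Ko ∧ Z ⟹ `MissingUpperBoundAt W 3`. Parity + Friedberg–Hoffstein (auxiliary
  modulus `2`: `d_K ≡ 1 (mod 8)` odd; `3 ∣ N` split, `d_K ≠ −3`), the Heegner point (Gross–Zagier non-torsion),
  Ko ⟹ co-STEP L at slack `v₃(c)`, K1's `Upper.jointUpperBoundAt_of_coStepL_manin` ⟹ JOINT upper half over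
  `(E, E^{d_K})`; Z pays `BSD₃` of a minimal model of the twist (again a non-CM O6 row, `r_an = 0`,
  `classO6_twist_of_heegner`), hence its LOWER half; `Upper.missingUpperBoundAt_of_jointUpper_of_lower` descends.
* §2 `upperHalf_of_kolyvaginCrux_of_rankZeroLeaf_of_nonTower` — on ALL onto wild rank-one rows: add NT off the
  tower (NT pays `BSD₃(E)`, which contains the upper half by `Typed.missingPPartAt_of_bsdp`).
* §3 **`psRankOneUpperHalfAtThree_of_soed : PublishedInputsWildThree → WildKolyvaginUpperAtThree →
  WildRankZeroTwistAtThree → WildRankOneSurjNonTowerAtThree → PSRankOneUpperHalfAtThree`** — CU's K2 BY NAME;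
  the principal-series binders (`v₃(Δ_min)` even, `Δ_min/3^v ≡ 1 (mod 3)`) and `¬ HasCM` are IDLE.

PLANNER-LEVEL READING (bookkeeping, not a ruling): as typed, K2 carries no content beyond SOED's {Ko, Z, NT}
restricted to the PS rows; the CU-specific alternative named in the item text («Kato's divisibility read
through the 3-adic Gross–Zagier formula, Kobayashi2013 Cor 1.3 (ii) shape») would be a DIFFERENT supply
for the same decl. BSD is not proved by any of this.

References: [GrossZagier1986] Thm. I.(6.3), (7.3); [JetchevSkinnerWan2017] §7.4.1 (arXiv:1512.06894 p. 30);
[FriedbergHoffstein1995] Thm. B; [Kolyvagin1990] Thm. A; [Jetchev2008] Thm. 1.4; [Miller2011LMS] Def. 1.1;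
[Zywina2015] Prop. 1.14/1.16.
-/

noncomputable section

open scoped Classical

set_option linter.dupNamespace false
set_option autoImplicit false

namespace Summit.BirchSwinnertonDyer.BirchSwinnertonDyer.Theorems.CyclotomicUntwistOfSOED

open WeierstrassCurve NumberField IsDedekindDomain Field
  Literature.NumberTheory.EllipticCurves
  Literature.NumberTheory.EllipticCurves.ModularForms
  Literature.NumberTheory.EllipticCurves.Rank1Residual
  Literature.NumberTheory.EllipticCurves.Rank1Residual.Typed
  Literature.NumberTheory.EllipticCurves.KrizLi2019
  Summit.BirchSwinnertonDyer.Rank1Residual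
  Summit.BirchSwinnertonDyer.Rank1Residual.Additive
  Summit.BirchSwinnertonDyer.Rank1Residual.X11b
  Summit.BirchSwinnertonDyer.BirchSwinnertonDyer.Theses.SemiOrdinaryEisensteinDescent

/-! ### §0 Two bookkeeping readings of the published inputs -/

/-- `BSD₃(E)` in analytic rank `≤ 1` contains the UPPER half `ord₃ #Ш(E) ≤ ord₃ #Ш_an(E)` (Miller's currency;
`Ш(E)` finite by Gross–Zagier–Kolyvagin). Bookkeeping. [cite: Miller2011LMS, Def. 1.1 (arXiv:1010.2431 p. 3)] -/
theorem missingUpperBoundAt_of_bsdp_of_gzk (hGZK : rank_eq_analyticRank_of_analyticRank_le_one)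
    (W : WeierstrassCurve ℚ) [W.IsElliptic] (p : ℕ) [Fact p.Prime] (hr : W.analyticRank ≤ 1)
    (h : BSDp W p) : MissingUpperBoundAt W p := by
  haveI : Finite W.sha := (hGZK W hr).2
  exact (lower_and_upper_of_missingPPartAt W p (missingPPartAt_of_bsdp W p h)).2

/-- `BSD₃(E)` in analytic rank `≤ 1` contains the LOWER half `ord₃ #Ш_an(E) ≤ ord₃ #Ш(E)`. Bookkeeping.
[cite: Miller2011LMS, Def. 1.1 (arXiv:1010.2431 p. 3)] -/
theorem missingLowerBoundAt_of_bsdp_of_gzk (hGZK : rank_eq_analyticRank_of_analyticRank_le_one)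
    (W : WeierstrassCurve ℚ) [W.IsElliptic] (p : ℕ) [Fact p.Prime] (hr : W.analyticRank ≤ 1)
    (h : BSDp W p) : MissingLowerBoundAt W p := by
  haveI : Finite W.sha := (hGZK W hr).2
  exact (lower_and_upper_of_missingPPartAt W p (missingPPartAt_of_bsdp W p h)).1

/-- **The rank-zero wild leaf pays BOTH halves of a minimal model of the Heegner twist.** For `W` on
`ClassO6 W 3` with `ρ̄_{E,3}` onto, an imaginary quadratic Heegner field `K` for `N(E)` with `d_K` odd and
`L(E^{d_K},1) ≠ 0`, and any globally minimal `Wd ≅ E^{d_K}`: `Wd` is again a non-CM O6 row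
(`classO6_twist_of_heegner`, `hasCM_iff_of_j_eq`, Zywina: onto mod `3` ⟹ no CM) of analytic rank `0`, so
`WAllExclAddWildRankZero` gives `BSDp Wd 3`, hence `MissingLowerBoundAt Wd 3 ∧ MissingUpperBoundAt Wd 3`.
CONDITIONAL on the leaf (hypothesis). [cite: Zywina2015, Prop. 1.14 and Prop. 1.16]
[cite: Miller2011LMS, Def. 1.1 (arXiv:1010.2431 p. 3)] -/
theorem twist_halves_of_rankZeroLeaf (hGZK : rank_eq_analyticRank_of_analyticRank_le_one)
    (hRZ : Summit.BirchSwinnertonDyer.WAllExclAddWildRankZero)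
    (W : WeierstrassCurve ℚ) [W.IsElliptic] [W.IsGloballyMinimal]
    (hO6 : ClassO6 W 3) (hsurj : W.HasSurjectiveModNGaloisRep 3)
    (K : Type) [Field K] [NumberField K] (hK : IsImaginaryQuadratic K) (hodd : Odd (NumberField.discr K))
    (hHN : SatisfiesHeegnerHypothesis (W.conductorNorm ℤ) K)
    (hLd : (W.quadraticTwist (NumberField.discr K : ℚ)).entireLFunction 1 ≠ 0)
    (Wd : WeierstrassCurve ℚ) [Wd.IsElliptic] [Wd.IsGloballyMinimal] (Cd : VariableChange ℚ)
    (hCd : Cd • W.quadraticTwist (NumberField.discr K : ℚ) = Wd) :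
    MissingLowerBoundAt Wd 3 ∧ MissingUpperBoundAt Wd 3 := by
  obtain ⟨hO6d, hjd⟩ := classO6_twist_of_heegner W hO6 K hK hHN hodd Wd Cd hCd
  have hCM : ¬ W.HasCM := fun hCM ↦
    W.not_hasSurjectiveModNGaloisRep_of_hasCM hCM Nat.prime_three (by decide) hsurj
  have hCMd : ¬ Wd.HasCM := fun h ↦ hCM ((hasCM_iff_of_j_eq hjd).mp h)
  have hD0 : (NumberField.discr K : ℚ) ≠ 0 := by exact_mod_cast NumberField.discr_ne_zero K
  haveI : (W.quadraticTwist (NumberField.discr K : ℚ)).IsElliptic := W.isElliptic_quadraticTwist hD0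
  have hLd1 : Wd.entireLFunction 1 ≠ 0 := by rw [← hCd, entireLFunction_smul]; exact hLd
  have hrd : Wd.analyticRank = 0 := analyticRank_eq_zero_of_entireLFunction_one_ne_zero Wd hLd1
  have hWd : BSDp Wd 3 := hRZ Wd hCMd hO6d hrd
  exact ⟨missingLowerBoundAt_of_bsdp_of_gzk hGZK Wd 3 (by omega) hWd,
    missingUpperBoundAt_of_bsdp_of_gzk hGZK Wd 3 (by omega) hWd⟩

/-! ### §1 The UPPER half on the tower-surjective onto wild rank-one rows from Ko and Z -/

/-- **UPPER half on the `3`-adic-tower-surjective onto wild rank-one rows ⟸ published inputs ∧ Kolyvagin crux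
Ko ∧ rank-zero wild leaf Z.** For `W` globally minimal on `ClassO6 W 3` with `ρ̄_{E,3}` onto, `TowerSurjThree W`
and `r_an = 1`: parity gives `w(E) = −1`; Friedberg–Hoffstein (auxiliary modulus `2`) an imaginary quadratic
Heegner `K` for `N(E)` with `2` split (`d_K` odd) and `L(E^{d_K},1) ≠ 0`; `3 ∣ N(E)` splits, so `d_K ≠ −3`
and `3 ∤ #𝓞_K^×`; the Heegner point `P` is non-torsion (Gross–Zagier). Ko gives co-STEP L
`Upper.IndexUpperBoundLeAt W 3 K P (v₃ c)`; K1's `Upper.jointUpperBoundAt_of_coStepL_manin` the JOINT upper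
half over `(E, E^{d_K})`; Z the LOWER half of a minimal model of the twist (`twist_halves_of_rankZeroLeaf`);
`Upper.missingUpperBoundAt_of_jointUpper_of_lower` descends to `MissingUpperBoundAt W 3`. CONDITIONAL; no
`p`-adic input. [cite: GrossZagier1986, Thm. I.(6.3) and (7.3)] [cite: FriedbergHoffstein1995, Thm. B]
[cite: JetchevSkinnerWan2017, §7.4.1 (arXiv:1512.06894 p. 30)] [cite: Jetchev2008, Thm. 1.4] -/
theorem upperHalf_towerRows_of_kolyvaginCrux_of_rankZeroLeaf (hF : PublishedInputsWildThree)
    (hKoly : WildKolyvaginUpperAtThree) (hZ : WildRankZeroTwistAtThree)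
    (W : WeierstrassCurve ℚ) [W.IsElliptic] [W.IsGloballyMinimal]
    (hO6 : ClassO6 W 3) (hsurj : W.HasSurjectiveModNGaloisRep 3)
    (htower : AdditiveThree.TowerSurjThree W) (hr : W.analyticRank = 1) :
    MissingUpperBoundAt W 3 := by
  obtain ⟨hGZ, hKo, hGZK, hmod, -, -, hGZ73, hFH, hpar, hHP⟩ := hF
  haveI hN0 : NeZero (W.conductorNorm ℤ) := ⟨W.conductorNorm_pos_holds.ne'⟩
  -- parity: `r_an = 1` is odd, so `w(E) = -1`
  have hw : W.rootNumber = -1 := by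
    rcases W.rootNumber_eq_one_or with h | h
    · exfalso
      have heven : Even W.analyticRank := (hpar W).mpr h
      rw [hr] at heven
      exact Nat.not_even_one heven
    · exact h
  -- Friedberg–Hoffstein with auxiliary modulus `2`: Heegner for `N(E)` and `2` split
  obtain ⟨K, _, _, hK, -, hHN, hH2, hLt⟩ := hFH W hw 2 two_ne_zero 0
  have hodd : Odd (NumberField.discr K) := by
    have h8 := Literature.SatisfiesHeegnerHypothesis.discr_emod_eight hK.1 hH2 (dvd_refl 2)
    rw [Int.odd_iff]; omega
  -- `3 ∣ N(E)` (additive) splits in `K`; hence `d_K ≠ -3` and `3 ∤ #𝓞_K^×`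
  have h3N : 3 ∣ W.conductorNorm ℤ :=
    (W.dvd_conductorNorm_iff_not_hasGoodReductionAtPrime 3).mpr (not_good_of_addv W 3 hO6.2.1)
  have hd3 : NumberField.discr K ≠ -3 := by
    intro h
    exact Literature.SatisfiesHeegnerHypothesis.not_dvd_discr hK.1 hHN Nat.prime_three h3N
      (by rw [h]; norm_num)
  have hwK : ¬ 3 ∣ Units.torsionOrder K :=
    (X11b.Three.not_dvd_discr_and_not_dvd_torsionOrder_of_heegner hK hHN (by decide) h3N).2
  -- the Heegner point over `K` and its data; non-torsion by Gross–Zagier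
  obtain ⟨P, Dt, H, ι, hP⟩ := hHP W K hK hHN
  have hL0 : W.entireLFunction 1 = 0 := entireLFunction_one_eq_zero_of_analyticRank_eq_one hr
  obtain ⟨-, hderiv⟩ := leadingLCoeff_eq_deriv_of_analyticRank_eq_one hr
  have hLK : LDerivEK W K ≠ 0 := by
    rw [lDerivEK_eq_deriv_mul W K hmod hL0]; exact mul_ne_zero hderiv hLt
  have hnt : ¬ IsOfFinAddOrder P :=
    (lDerivEK_ne_zero_iff_not_isOfFinAddOrder W (W.conductorNorm ℤ) K (hGZ _ W K) hK hHN
      ⟨Dt, H, ι, hP⟩).mp hLK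
  -- co-STEP L at slack `v₃(c)` IS the Kolyvagin crux (tower surjectivity, `d_K` odd and `≠ -3`)
  have hupI : SchneiderFree.Upper.IndexUpperBoundLeAt W 3 K P (padicValNat 3 Dt.c.natAbs) :=
    hKoly W (W.conductorNorm ℤ) K Dt H ι P hO6 hsurj hr rfl hK hHN hLt hP hnt hodd hd3 htower
  -- a globally minimal model of the twist; its halves from the rank-zero wild leaf
  have hD0 : (NumberField.discr K : ℚ) ≠ 0 := by exact_mod_cast NumberField.discr_ne_zero K
  haveI : (W.quadraticTwist (NumberField.discr K : ℚ)).IsElliptic := W.isElliptic_quadraticTwist hD0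
  obtain ⟨Cd, hCd⟩ := hasGlobalMinimalModel_rat_holds (W.quadraticTwist (NumberField.discr K : ℚ))
  haveI : (Cd • W.quadraticTwist (NumberField.discr K : ℚ)).IsGloballyMinimal := hCd
  obtain ⟨hdlo, -⟩ := twist_halves_of_rankZeroLeaf hGZK hZ W hO6 hsurj K hK hodd hHN hLt
    (Cd • W.quadraticTwist (NumberField.discr K : ℚ)) Cd rfl
  -- JOINT upper half over the pair, then descend with the twist's lower half
  exact SchneiderFree.Upper.missingUpperBoundAt_of_jointUpper_of_lower
    (SchneiderFree.Upper.jointUpperBoundAt_of_coStepL_manin hGZ hKo hGZK hmod hGZ73 W 3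
      (W.conductorNorm ℤ) K Dt H ι P (Cd • W.quadraticTwist (NumberField.discr K : ℚ)) hr rfl h3N hK
      hodd hwK hHN hLt hP ⟨Cd, rfl⟩ (by decide) hupI) hdlo

/-! ### §2 The UPPER half on ALL onto wild rank-one rows: add the non-tower residual -/

/-- **UPPER half on every onto wild rank-one row ⟸ published inputs ∧ Ko ∧ Z ∧ NT.** Off the
`3`-adic-tower-surjective rows the residual NT pays `BSD₃(E)` (hence the upper half); on them §1.
CONDITIONAL. [cite: JetchevSkinnerWan2017, §7.4.1 (arXiv:1512.06894 p. 30)] [cite: Miller2011LMS, Def. 1.1] -/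
theorem upperHalf_of_kolyvaginCrux_of_rankZeroLeaf_of_nonTower (hF : PublishedInputsWildThree)
    (hKoly : WildKolyvaginUpperAtThree) (hZ : WildRankZeroTwistAtThree)
    (hNT : WildRankOneSurjNonTowerAtThree)
    (W : WeierstrassCurve ℚ) [W.IsElliptic] [W.IsGloballyMinimal] (hncm : ¬ W.HasCM)
    (hO6 : ClassO6 W 3) (hsurj : W.HasSurjectiveModNGaloisRep 3) (hr : W.analyticRank = 1) :
    MissingUpperBoundAt W 3 := by
  by_cases htower : AdditiveThree.TowerSurjThree W
  · exact upperHalf_towerRows_of_kolyvaginCrux_of_rankZeroLeaf hF hKoly hZ W hO6 hsurj htower hr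
  · exact missingUpperBoundAt_of_bsdp_of_gzk hF.2.2.1 W 3 (by omega) (hNT W hncm hO6 hsurj htower hr)

/-! ### §3 Route `CyclotomicUntwist`, crux K2 BY NAME -/

/-- **CU's K2 `PSRankOneUpperHalfAtThree` (stmt-BirchSwinnertonDyer-21581) from SOED's published inputs,
Kolyvagin crux Ko (20480), rank-zero wild leaf Z (20387) and non-tower residual NT (20484).** The
principal-series binders of K2 (`v₃(Δ_min)` even, `Δ_min/3^v ≡ 1 (mod 3)`) are not used: the supply is the
whole onto wild rank-one leaf (§2). CONDITIONAL cross-route kernel; closes nothing; BSD is not proved by this.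
[cite: JetchevSkinnerWan2017, §7.4.1 (arXiv:1512.06894 p. 30)] [cite: GrossZagier1986, Thm. I.(6.3) and (7.3)]
[cite: FriedbergHoffstein1995, Thm. B] -/
theorem psRankOneUpperHalfAtThree_of_soed (hF : PublishedInputsWildThree) (hKoly : WildKolyvaginUpperAtThree)
    (hZ : WildRankZeroTwistAtThree) (hNT : WildRankOneSurjNonTowerAtThree) :
    Summit.BirchSwinnertonDyer.BirchSwinnertonDyer.Theses.CyclotomicUntwist.PSRankOneUpperHalfAtThree := by
  intro W _ _ hncm hO6 hsurj _hev _hsq hr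
  exact upperHalf_of_kolyvaginCrux_of_rankZeroLeaf_of_nonTower hF hKoly hZ hNT W hncm hO6 hsurj hr

/-- **The tower-row half of K2 needs neither NT nor `¬ HasCM`:** on the PS rows with `3`-adic tower surjective,
published inputs ∧ Ko ∧ Z ⟹ `MissingUpperBoundAt W 3` — the shape of the birth line's `stub_upperHalf_tower`
with its tower binder read as `TowerSurjThree` (`n ≥ 1`). CONDITIONAL. [cite: JetchevSkinnerWan2017, §7.4.1]
[cite: Jetchev2008, Thm. 1.4] -/
theorem psRankOneUpperHalfAtThree_towerRows_of_soed (hF : PublishedInputsWildThree)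
    (hKoly : WildKolyvaginUpperAtThree) (hZ : WildRankZeroTwistAtThree) :
    ∀ (W : WeierstrassCurve ℚ) [W.IsElliptic] [W.IsGloballyMinimal],
      ClassO6 W 3 → Surj W 3 → AdditiveThree.TowerSurjThree W →
      Even (padicValInt 3 W.minimalDiscriminantInt) →
      W.minimalDiscriminantInt / 3 ^ padicValInt 3 W.minimalDiscriminantInt % 3 = 1 →
      W.analyticRank = 1 → MissingUpperBoundAt W 3 := by
  intro W _ _ hO6 hsurj htower _hev _hsq hr
  exact upperHalf_towerRows_of_kolyvaginCrux_of_rankZeroLeaf hF hKoly hZ W hO6 hsurj htower hr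

/-! ### §4 (appended) The K2 birth line's registered stubs, in THEIR binders, modulo SOED -/

/-- The birth skeleton's tower binder `∀ n, ρ̄_{E,3^n} onto` (all `n : ℕ`, the level-`3⁰` case being the trivial
group) is the tree's `AdditiveThree.TowerSurjThree W` (`n ≥ 1`). [cite: GrossLMS1991, §1] -/
theorem forall_hasSurjectiveModNGaloisRep_pow_three_iff_towerSurjThree (W : WeierstrassCurve ℚ) [W.IsElliptic] :
    (∀ n : ℕ, W.HasSurjectiveModNGaloisRep (3 ^ n : ℕ)) ↔ AdditiveThree.TowerSurjThree W := by
  refine ⟨fun h n _ ↦ h n, fun hT n ↦ ?_⟩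
  cases n with
  | zero =>
    haveI : Subsingleton (geomTorsion W ((3 ^ 0 : ℕ) : ℤ)) := ⟨fun a b ↦ by
      have ha := AddSubgroup.torsionBy.nsmul_iff.mp a.2
      have hb := AddSubgroup.torsionBy.nsmul_iff.mp b.2
      simp only [pow_zero, one_smul] at ha hb
      exact Subtype.ext (ha.trans hb.symm)⟩
    intro y
    exact ⟨1, Multiplicative.toAdd.injective (AddEquiv.ext fun a ↦ Subsingleton.elim _ _)⟩
  | succ k => exact_mod_cast hT (k + 1) k.succ_pos

/-- **The K2 birth line's `stub_upperHalf_tower`, VERBATIM binders, modulo SOED's published inputs ∧ Ko ∧ Z** (the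
stub's research content is Ko; CONDITIONAL — a registered stub closes only unconditionally, so this is a helper, not a
stub proof). [cite: JetchevSkinnerWan2017, §7.4.1 (arXiv:1512.06894 p. 30)] [cite: Jetchev2008, Thm. 1.4] -/
theorem stub_upperHalf_tower_of_soed (hF : PublishedInputsWildThree) (hKoly : WildKolyvaginUpperAtThree)
    (hZ : WildRankZeroTwistAtThree) :
    ∀ (W : WeierstrassCurve ℚ) [W.IsElliptic] [W.IsGloballyMinimal],
      ¬ W.HasCM → ClassO6 W 3 → Surj W 3 → (∀ n : ℕ, W.HasSurjectiveModNGaloisRep (3 ^ n : ℕ)) →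
      Even (padicValInt 3 W.minimalDiscriminantInt) →
      W.minimalDiscriminantInt / 3 ^ padicValInt 3 W.minimalDiscriminantInt % 3 = 1 →
      W.analyticRank = 1 → MissingUpperBoundAt W 3 := by
  intro W _ _ _hncm hO6 hsurj htow _hev _hsq hr
  exact upperHalf_towerRows_of_kolyvaginCrux_of_rankZeroLeaf hF hKoly hZ W hO6 hsurj
    ((forall_hasSurjectiveModNGaloisRep_pow_three_iff_towerSurjThree W).mp htow) hr

/-- **The K2 birth line's `stub_upperHalf_nonTower`, VERBATIM binders, modulo Gross–Zagier–Kolyvagin and SOED's NT**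
(NT pays `BSD₃` on the non-tower rows; CONDITIONAL helper, not a stub proof). [cite: Jetchev2008, Thm. 1.4]
[cite: Miller2011LMS, Def. 1.1 (arXiv:1010.2431 p. 3)] -/
theorem stub_upperHalf_nonTower_of_nonTowerResidual (hGZK : rank_eq_analyticRank_of_analyticRank_le_one)
    (hNT : WildRankOneSurjNonTowerAtThree) :
    ∀ (W : WeierstrassCurve ℚ) [W.IsElliptic] [W.IsGloballyMinimal],
      ¬ W.HasCM → ClassO6 W 3 → Surj W 3 → ¬ (∀ n : ℕ, W.HasSurjectiveModNGaloisRep (3 ^ n : ℕ)) →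
      Even (padicValInt 3 W.minimalDiscriminantInt) →
      W.minimalDiscriminantInt / 3 ^ padicValInt 3 W.minimalDiscriminantInt % 3 = 1 →
      W.analyticRank = 1 → MissingUpperBoundAt W 3 := by
  intro W _ _ hncm hO6 hsurj hntow _hev _hsq hr
  have hnt : ¬ AdditiveThree.TowerSurjThree W :=
    fun hT ↦ hntow ((forall_hasSurjectiveModNGaloisRep_pow_three_iff_towerSurjThree W).mpr hT)
  exact missingUpperBoundAt_of_bsdp_of_gzk hGZK W 3 (by omega) (hNT W hncm hO6 hsurj hnt hr)

/-- **K2's registered composition fed by the two conditional stub supplies:** published inputs ∧ Ko ∧ Z ∧ NT ⟹ K2, through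
the birth skeleton's own case split on `∀ n, ρ̄_{E,3^n} onto` (same statement as `psRankOneUpperHalfAtThree_of_soed`,
routed through the stubs' binders). [cite: JetchevSkinnerWan2017, §7.4.1 (arXiv:1512.06894 p. 30)] -/
theorem psRankOneUpperHalfAtThree_of_stubSupplies (hF : PublishedInputsWildThree) (hKoly : WildKolyvaginUpperAtThree)
    (hZ : WildRankZeroTwistAtThree) (hNT : WildRankOneSurjNonTowerAtThree) :
    Summit.BirchSwinnertonDyer.BirchSwinnertonDyer.Theses.CyclotomicUntwist.PSRankOneUpperHalfAtThree := by
  intro W _ _ hncm hO6 hsurj hev hsq hr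
  by_cases htow : ∀ n : ℕ, W.HasSurjectiveModNGaloisRep (3 ^ n : ℕ)
  · exact stub_upperHalf_tower_of_soed hF hKoly hZ W hncm hO6 hsurj htow hev hsq hr
  · exact stub_upperHalf_nonTower_of_nonTowerResidual hF.2.2.1 hNT W hncm hO6 hsurj htow hev hsq hr

end Summit.BirchSwinnertonDyer.BirchSwinnertonDyer.Theorems.CyclotomicUntwistOfSOED

end
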